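import Summits.FinalStateConjecture.FinalStateConjecture.Theorems.EIHFluxBalanceInertialRecessionStubSlavingCOERLieKernel
import Summits.FinalStateConjecture.FinalStateConjecture.Theorems.EIHFluxBalanceInertialRecessionSlavingAxisKernel
import Summits.FinalStateConjecture.FinalStateConjecture.Theorems.EIHFluxBalanceInertialRecessionLorentz
import Literature.Geometry.Lorentzian.KerrAxialKillingField

/-!
# Route EIHFluxBalance — `InertialRecession` (E′), line `SketchCleanExcision`, skeleton r13,
# stub `stub_coerSymbolQuant` (C): NORMALISATION of an infinitesimal Poincaré motion modulo the
# Kerr–Schild stabiliser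

Helper file for the crux `stmt-FinalStateConjecture-17403`
(`Summit.FinalStateConjecture.FinalStateConjecture.Theses.EIHFluxBalance.InertialRecession`, E′),
registered stub `stub_coerSymbolQuant` (quantitative uniform robust COER-B, compactness argument).
The rest-frame first variation `𝓛(A,d)(y)(v,w) = ∂_{Ay+d} g_{M,a}(y)(v,w) + g(Av,w) + g(v,Aw)` of the
Kerr–Schild form under the infinitesimal Poincaré motion `z ↦ Az + d` (`A` `η`-skew) does not see
the stabiliser: rest time translations `d ↦ d + τ e₀` (stationarity,
`Kerr.fderiv_bilin_basisVector_zero`) and the axial rotation rate (every spin; all rotation rates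
at `a = 0`). Here:

* `coerSym_axialGenerator_facts` — the generator `J = dx¹ ⊗ e₂ − dx² ⊗ e₁` (`E4.axialGenerator`,
  Killing for `g_{M,a}`, every spin: `Kerr.fderiv_bilin_axialGenerator`) is `η`-skew and kills
  `e₀`, `e₃`;
* `coerSym_normalise` — **normalisation**: every `(A, d)` can be replaced by a skew `A'` and a `d'`
  with the SAME first variation at every `y` with `r(y) > 0`, the same reduced data
  `A'e₀ = Ae₀`, `d'⃗ = d⃗`, `a A'e₃ = a Ae₃`, and norms controlled by the reduced size
  `red = ‖Ae₀‖ + ‖d⃗‖ + ‖a Ae₃‖`: `‖A'‖ ≤ (3 + 3|a|⁻¹) red`, `‖d'‖ ≤ red`;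
* `coerSym_lieForm_smul`, `coerSym_red_smul` — homogeneity in `(A, d)`.

Elementary; no definitions, no named facts, no `sorry`.
-/

set_option linter.dupNamespace false
set_option maxSynthPendingDepth 3

noncomputable section

open Set Function Literature.Geometry.Lorentzian Literature.Geometry.Lorentzian.Schwarzschild
  Summit.FinalStateConjecture.FinalStateConjecture.Theorems
open scoped InnerProductSpace

namespace Summit.FinalStateConjecture.FinalStateConjecture.Theorems.SublinearIsFree.Slaving

/-! ### Coordinates and norms on `E4` -/

section Norms

/-- `‖T‖ ≤ ∑_μ ‖T e_μ‖` for an operator on `E4`. [folklore] -/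
theorem coerSym_opNorm_le_sum {F : Type*} [NormedAddCommGroup F] [NormedSpace ℝ F] (T : E4 →L[ℝ] F) :
    ‖T‖ ≤ ∑ μ, ‖T (E4.basisVector μ)‖ := by
  refine ContinuousLinearMap.opNorm_le_bound _ (Finset.sum_nonneg fun μ _ ↦ norm_nonneg _)
    fun v ↦ ?_
  conv_lhs => rw [Kerr.eq_sum_basisVector v, map_sum]
  refine (norm_sum_le _ _).trans ?_
  rw [Finset.sum_mul]
  refine Finset.sum_le_sum fun μ _ ↦ ?_
  rw [map_smul, norm_smul, Real.norm_eq_abs, mul_comm]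
  exact mul_le_mul_of_nonneg_left (by simpa using PiLp.norm_apply_le v μ) (norm_nonneg _)

end Norms

/-! ### The axial rotation generator -/

section Axial

/-- The axial generator `J = dx¹ ⊗ e₂ − dx² ⊗ e₁` (`E4.axialGenerator`) is `η`-skew, kills `e₀` and
`e₃`, and maps `e₁ ↦ e₂`, `e₂ ↦ −e₁`. [folklore] -/
theorem coerSym_axialGenerator_facts :
    (∀ u w : E4, Minkowski.bilin (E4.axialGenerator u) w + Minkowski.bilin u (E4.axialGenerator w) = 0) ∧
    E4.axialGenerator (E4.basisVector 0) = 0 ∧ E4.axialGenerator (E4.basisVector 3) = 0 ∧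
    E4.axialGenerator (E4.basisVector 1) = E4.basisVector 2 ∧
    E4.axialGenerator (E4.basisVector 2) = -E4.basisVector 1 := by
  refine ⟨fun u w ↦ ?_, E4.axialGenerator_basisVector_zero, ?_, ?_, ?_⟩
  · rw [minkowski_apply_eq, minkowski_apply_eq, E4.axialGenerator_apply_zero, E4.axialGenerator_apply_one,
      E4.axialGenerator_apply_two, E4.axialGenerator_apply_three, E4.axialGenerator_apply_zero,
      E4.axialGenerator_apply_one, E4.axialGenerator_apply_two, E4.axialGenerator_apply_three]
    ring
  all_goals rw [E4.axialGenerator_apply]; ext i; fin_cases i <;> simp [E4.basisVector]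

end Axial

/-! ### The boost generator attached to a spatial vector (`a = 0` normalisation) -/

section Boost

/-- The boost generator `ω_b v = (⟪b⃗, v⃗⟫, v⁰ b⃗)` as an operator: `ω_b = ⟪b⃗,·⟫ ⊗ e₀ + dx⁰ ⊗ (0, b⃗)`.
[folklore] -/
theorem coerSym_boostGen_apply (b v : E4) : ((sdotCLM b).smulRight (E4.basisVector 0) + (E4.dx 0).smulRight (E4.ofTimeSpace 0 (E4.spatial b)) : E4 →L[ℝ] E4) v = E4.ofTimeSpace (sdot b v) (v 0 • E4.spatial b) := by
  ext i
  refine Fin.cases ?_ (fun j ↦ ?_) i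
  · simp [sdotCLM_apply, E4.basisVector]
  · simp [sdotCLM_apply, E4.basisVector, Fin.succ_ne_zero]

/-- The boost generator is `η`-skew. [folklore] -/
theorem coerSym_boostGen_skew (b u w : E4) :
    Minkowski.bilin (((sdotCLM b).smulRight (E4.basisVector 0) + (E4.dx 0).smulRight (E4.ofTimeSpace 0 (E4.spatial b)) : E4 →L[ℝ] E4) u) w +
      Minkowski.bilin u (((sdotCLM b).smulRight (E4.basisVector 0) + (E4.dx 0).smulRight (E4.ofTimeSpace 0 (E4.spatial b)) : E4 →L[ℝ] E4) w) = 0 := by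
  rw [coerSym_boostGen_apply, coerSym_boostGen_apply, Kerr.minkowski_bilin_eq_spatial,
    Kerr.minkowski_bilin_eq_spatial]
  simp only [E4.ofTimeSpace_apply_zero, E4.spatial_ofTimeSpace, sdot, inner_smul_left,
    inner_smul_right, RCLike.conj_to_real, real_inner_comm (E4.spatial b)]
  ring

/-- Operator norm of the boost generator: `‖ω_b‖ ≤ 2‖b‖`. [folklore] -/
theorem coerSym_norm_boostGen_le (b : E4) : ‖((sdotCLM b).smulRight (E4.basisVector 0) + (E4.dx 0).smulRight (E4.ofTimeSpace 0 (E4.spatial b)) : E4 →L[ℝ] E4)‖ ≤ 2 * ‖b‖ := by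
  have hsp : ∀ u : E4, ‖E4.spatial u‖ ≤ ‖u‖ := fun u ↦ by
    have h := norm_sq_eq_sq_add_spatialNorm_sq u
    rw [E4.spatialNorm] at h
    nlinarith [norm_nonneg u, norm_nonneg (E4.spatial u), sq_nonneg (u 0)]
  have h0 : ‖E4.ofTimeSpace 0 (E4.spatial b)‖ = ‖E4.spatial b‖ := by
    rw [norm_eq_spatialNorm_of_apply_zero_eq_zero (E4.ofTimeSpace_apply_zero 0 _), E4.spatialNorm,
      E4.spatial_ofTimeSpace]
  refine ContinuousLinearMap.opNorm_le_bound _ (by positivity) fun v ↦ ?_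
  rw [add_apply, ContinuousLinearMap.smulRight_apply, ContinuousLinearMap.smulRight_apply]
  refine (norm_add_le _ _).trans ?_
  rw [norm_smul, norm_smul, PiLp.norm_single, norm_one, mul_one, h0,
    Real.norm_eq_abs, Real.norm_eq_abs, sdotCLM_apply, sdot, show E4.dx 0 v = v 0 from rfl]
  have h1 : |⟪E4.spatial b, E4.spatial v⟫_ℝ| ≤ ‖b‖ * ‖v‖ :=
    (abs_real_inner_le_norm _ _).trans (mul_le_mul (hsp b) (hsp v) (norm_nonneg _) (norm_nonneg _))
  have hv0 : |v 0| ≤ ‖v‖ := by simpa using PiLp.norm_apply_le v 0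
  have h2 : |v 0| * ‖E4.spatial b‖ ≤ ‖v‖ * ‖b‖ := mul_le_mul hv0 (hsp b) (norm_nonneg _) (norm_nonneg _)
  nlinarith [h1, h2]

end Boost

/-! ### Homogeneity -/

section Homogeneity

/-- The first variation is linear in `(A, d)`: scaling. [folklore] -/
theorem coerSym_lieForm_smul (M a : ℝ) (y : E4) (A : E4 →L[ℝ] E4) (d : E4) (t : ℝ) (v w : E4) :
    fderiv ℝ (Kerr.bilin M a) y ((t • A) y + t • d) v w + Kerr.bilin M a y ((t • A) v) w +
        Kerr.bilin M a y v ((t • A) w) =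
      t * (fderiv ℝ (Kerr.bilin M a) y (A y + d) v w + Kerr.bilin M a y (A v) w + Kerr.bilin M a y v (A w)) := by
  simp only [FunLike.coe_smul, Pi.smul_apply, ← smul_add, map_smul, smul_eq_mul]
  ring

/-- The reduced size is absolutely homogeneous. [folklore] -/
theorem coerSym_red_smul (a : ℝ) (A : E4 →L[ℝ] E4) (d : E4) (t : ℝ) :
    ‖(t • A) (E4.basisVector 0)‖ + ‖E4.spatial (t • d)‖ + ‖a • (t • A) (E4.basisVector 3)‖ =
      |t| * (‖A (E4.basisVector 0)‖ + ‖E4.spatial d‖ + ‖a • A (E4.basisVector 3)‖) := by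
  rw [FunLike.coe_smul, Pi.smul_apply, Pi.smul_apply, map_smul, smul_comm a t,
    norm_smul, norm_smul, norm_smul, Real.norm_eq_abs]
  ring

/-- Skewness is preserved by scaling. [folklore] -/
theorem coerSym_skew_smul {A : E4 →L[ℝ] E4}
    (hA : ∀ u w : E4, Minkowski.bilin (A u) w + Minkowski.bilin u (A w) = 0) (t : ℝ) (u w : E4) :
    Minkowski.bilin ((t • A) u) w + Minkowski.bilin u ((t • A) w) = 0 := by
  rw [FunLike.coe_smul, Pi.smul_apply, Pi.smul_apply, map_smul, map_smul,
    smul_apply, smul_eq_mul, smul_eq_mul, ← mul_add, hA, mul_zero]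

end Homogeneity

/-! ### Normalisation modulo the stabiliser -/

section Normalise

/-- **Normalisation of an infinitesimal Poincaré motion modulo the Kerr–Schild stabiliser.** For
`A` `η`-skew and `d ∈ E4` there are a skew `A'` and a `d'` with the same rest-frame first variation
`∂_{A'y+d'} g_{M,a} + g(A'·,·) + g(·,A'·) = ∂_{Ay+d} g_{M,a} + g(A·,·) + g(·,A·)` at every `y` with
`r(y) > 0`, the same reduced data `A'e₀ = Ae₀`, `d'⃗ = d⃗`, `a A'e₃ = a Ae₃`, and
`‖A'‖ ≤ (3 + 3|a|⁻¹) red`, `‖d'‖ ≤ red`, `red = ‖Ae₀‖ + ‖d⃗‖ + ‖a Ae₃‖`: subtract the rest time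
translation `d⁰ e₀` (stationarity `Kerr.fderiv_bilin_basisVector_zero`) and, for `a ≠ 0`, the axial
rotation rate `(Ae₁)² J` (`Kerr.fderiv_bilin_axialGenerator`); for `a = 0` keep only the boost part
`ω_{Ae₀}` (all rotations are Killing, `lieDeriv_bilin_zero_spin_rotation_eq_zero`,
`skew_decomposition`). [folklore] -/
theorem coerSym_normalise (M a : ℝ) {A : E4 →L[ℝ] E4}
    (hA : ∀ u w : E4, Minkowski.bilin (A u) w + Minkowski.bilin u (A w) = 0) (d : E4) :
    ∃ (A' : E4 →L[ℝ] E4) (d' : E4),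
      (∀ u w : E4, Minkowski.bilin (A' u) w + Minkowski.bilin u (A' w) = 0) ∧
      (∀ y : E4, 0 < Kerr.radius a y → ∀ v w : E4,
        fderiv ℝ (Kerr.bilin M a) y (A' y + d') v w + Kerr.bilin M a y (A' v) w + Kerr.bilin M a y v (A' w) =
          fderiv ℝ (Kerr.bilin M a) y (A y + d) v w + Kerr.bilin M a y (A v) w + Kerr.bilin M a y v (A w)) ∧
      A' (E4.basisVector 0) = A (E4.basisVector 0) ∧ E4.spatial d' = E4.spatial d ∧
      a • A' (E4.basisVector 3) = a • A (E4.basisVector 3) ∧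
      ‖A'‖ ≤ (3 + 3 * |a|⁻¹) * (‖A (E4.basisVector 0)‖ + ‖E4.spatial d‖ + ‖a • A (E4.basisVector 3)‖) ∧
      ‖d'‖ ≤ ‖A (E4.basisVector 0)‖ + ‖E4.spatial d‖ + ‖a • A (E4.basisVector 3)‖ := by
  -- the translation part
  set d' : E4 := d - d 0 • E4.basisVector 0 with hd'
  have hd'0 : d' 0 = 0 := by simp [hd']
  have hd's : E4.spatial d' = E4.spatial d := by
    ext i; simp [hd', E4.basisVector]
  have hd'n : ‖d'‖ = ‖E4.spatial d‖ := by
    rw [norm_eq_spatialNorm_of_apply_zero_eq_zero hd'0, E4.spatialNorm, hd's]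
  have hred0 : ‖E4.spatial d‖ ≤ ‖A (E4.basisVector 0)‖ + ‖E4.spatial d‖ + ‖a • A (E4.basisVector 3)‖ := by
    linarith [norm_nonneg (A (E4.basisVector 0)), norm_nonneg (a • A (E4.basisVector 3))]
  have hdiff : ∀ y : E4, 0 < Kerr.radius a y → DifferentiableAt ℝ (Kerr.bilin M a) y := fun y hy ↦
    (Kerr.contDiffAt_bilin M a hy (n := 1)).differentiableAt one_ne_zero
  rcases eq_or_ne a 0 with rfl | ha
  · -- `a = 0`: keep only the boost part `ω_b`, `b = A e₀`
    set b : E4 := A (E4.basisVector 0) with hb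
    set Kb : E4 →L[ℝ] E4 := ((sdotCLM b).smulRight (E4.basisVector 0) + (E4.dx 0).smulRight (E4.ofTimeSpace 0 (E4.spatial b)) : E4 →L[ℝ] E4) with hKb
    have hb0 : b 0 = 0 := skew_apply_zero_zero A hA
    have he0 : E4.basisVector 0 = E4.ofTimeSpace 1 (0 : E3) := by
      ext i; refine Fin.cases ?_ (fun j ↦ ?_) i <;> simp
    have hb' : A (E4.ofTimeSpace 1 0) = b := by rw [← he0]
    obtain ⟨-, hρ0, -, hρskew⟩ := skew_decomposition hA
    rw [hb'] at hρ0 hρskew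
    have hKbapply : ∀ v, Kb v = E4.ofTimeSpace (sdot b v) (v 0 • E4.spatial b) := coerSym_boostGen_apply b
    have hse0 : E4.spatial (E4.basisVector 0) = 0 := by
      ext i; simp [E4.basisVector]
    refine ⟨Kb, d', fun u w ↦ coerSym_boostGen_skew b u w, fun y hy v w ↦ ?_, ?_, hd's, by simp, ?_,
      hd'n.le.trans hred0⟩
    · have hys : E4.spatial y ≠ 0 := by
        rw [Kerr.radius_zero_left, E4.spatialNorm] at hy; exact norm_pos_iff.1 hy
      have hrot := lieDeriv_bilin_zero_spin_rotation_eq_zero M hys (R := fun v ↦ A v - Kb v)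
        (fun v ↦ by rw [hKbapply]; exact hρ0 v) (fun u w ↦ by rw [hKbapply, hKbapply]; exact hρskew u w) v w
      rw [hd', map_add, map_sub, map_smul, Kerr.fderiv_bilin_basisVector_zero M 0 (hdiff y hy), smul_zero,
        sub_zero, map_add]
      simp only [map_sub, add_apply, sub_apply] at hrot ⊢
      linear_combination (-1 : ℝ) * hrot
    · rw [hKbapply]
      have h1 : sdot b (E4.basisVector 0) = 0 := by simp [sdot, hse0]
      rw [h1, show (E4.basisVector 0 : E4) 0 = 1 by simp [E4.basisVector], one_smul]
      conv_rhs => rw [← E4.ofTimeSpace_time_spatial b, E4.time_apply, hb0]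
    · rw [abs_zero, inv_zero, mul_zero, add_zero, zero_smul, norm_zero, add_zero]
      have h := coerSym_norm_boostGen_le b
      nlinarith [norm_nonneg b, norm_nonneg (E4.spatial d)]
  · -- `a ≠ 0`: remove the axial rotation rate `ω = (A e₁)²`
    generalize hR₃ : E4.axialGenerator = R₃
    have hfacts := coerSym_axialGenerator_facts
    rw [hR₃] at hfacts
    obtain ⟨hRskew, hR0, hR3, hR1, hR2⟩ := hfacts
    set ω : ℝ := A (E4.basisVector 1) 2 with hω
    set A' : E4 →L[ℝ] E4 := A - ω • R₃ with hA'
    have hA'apply : ∀ v, A' v = A v - ω • R₃ v := fun v ↦ by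
      simp only [hA', sub_apply, FunLike.coe_smul, Pi.smul_apply]
    -- components of `A` from skewness
    have f10 : A (E4.basisVector 1) 0 = A (E4.basisVector 0) 1 := by
      simpa using skew_apply_succ_zero A hA 0
    have f11 : A (E4.basisVector 1) 1 = 0 := by
      have h := skew_apply_succ_succ A hA 0 0; simp at h; linarith
    have f13 : A (E4.basisVector 1) 3 = -A (E4.basisVector 3) 1 := by
      have h := skew_apply_succ_succ A hA 0 2
      simpa [show (2 : Fin 3).succ = (3 : Fin 4) from rfl] using h
    have f20 : A (E4.basisVector 2) 0 = A (E4.basisVector 0) 2 := by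
      simpa using skew_apply_succ_zero A hA 1
    have f21 : A (E4.basisVector 2) 1 = -ω := by
      have h := skew_apply_succ_succ A hA 1 0; simpa using h
    have f22 : A (E4.basisVector 2) 2 = 0 := by
      have h := skew_apply_succ_succ A hA 1 1; simp at h; linarith
    have f23 : A (E4.basisVector 2) 3 = -A (E4.basisVector 3) 2 := by
      have h := skew_apply_succ_succ A hA 1 2
      simpa [show (2 : Fin 3).succ = (3 : Fin 4) from rfl] using h
    have hA'e1 : A' (E4.basisVector 1) =
        A (E4.basisVector 0) 1 • E4.basisVector 0 - A (E4.basisVector 3) 1 • E4.basisVector 3 := by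
      rw [hA'apply, hR1]
      ext i
      fin_cases i <;> simp [E4.basisVector, f10, f11, f13, hω]
    have hA'e2 : A' (E4.basisVector 2) =
        A (E4.basisVector 0) 2 • E4.basisVector 0 - A (E4.basisVector 3) 2 • E4.basisVector 3 := by
      rw [hA'apply, hR2]
      ext i
      fin_cases i <;> simp [E4.basisVector, f20, f21, f22, f23]
    have hA'e0 : A' (E4.basisVector 0) = A (E4.basisVector 0) := by rw [hA'apply, hR0, smul_zero, sub_zero]
    have hA'e3 : A' (E4.basisVector 3) = A (E4.basisVector 3) := by rw [hA'apply, hR3, smul_zero, sub_zero]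
    have hn1 : ‖A' (E4.basisVector 1)‖ ≤ ‖A (E4.basisVector 0)‖ + ‖A (E4.basisVector 3)‖ := by
      rw [hA'e1]
      refine (norm_sub_le _ _).trans ?_
      rw [norm_smul, norm_smul, PiLp.norm_single, PiLp.norm_single, norm_one, mul_one, mul_one,
        Real.norm_eq_abs, Real.norm_eq_abs]
      exact add_le_add (by simpa using PiLp.norm_apply_le (A (E4.basisVector 0)) 1)
        (by simpa using PiLp.norm_apply_le (A (E4.basisVector 3)) 1)
    have hn2 : ‖A' (E4.basisVector 2)‖ ≤ ‖A (E4.basisVector 0)‖ + ‖A (E4.basisVector 3)‖ := by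
      rw [hA'e2]
      refine (norm_sub_le _ _).trans ?_
      rw [norm_smul, norm_smul, PiLp.norm_single, PiLp.norm_single, norm_one, mul_one, mul_one,
        Real.norm_eq_abs, Real.norm_eq_abs]
      exact add_le_add (by simpa using PiLp.norm_apply_le (A (E4.basisVector 0)) 2)
        (by simpa using PiLp.norm_apply_le (A (E4.basisVector 3)) 2)
    have hnA' : ‖A'‖ ≤ 3 * ‖A (E4.basisVector 0)‖ + 3 * ‖A (E4.basisVector 3)‖ := by
      have h := coerSym_opNorm_le_sum A'
      rw [Fin.sum_univ_four, hA'e0, hA'e3] at h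
      linarith
    have hn3 : ‖A (E4.basisVector 3)‖ = |a|⁻¹ * ‖a • A (E4.basisVector 3)‖ := by
      rw [norm_smul, Real.norm_eq_abs, ← mul_assoc, inv_mul_cancel₀ (abs_ne_zero.2 ha), one_mul]
    refine ⟨A', d', fun u w ↦ ?_, fun y hy v w ↦ ?_, hA'e0, hd's, by rw [hA'e3], ?_, hd'n.le.trans hred0⟩
    · rw [hA'apply, hA'apply, map_sub, map_smul, map_sub, map_smul, sub_apply, smul_apply, smul_eq_mul,
        smul_eq_mul]
      linear_combination hA u w - ω * hRskew u w
    · have hkill := Kerr.fderiv_bilin_axialGenerator M a (hdiff y hy) v w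
      rw [hR₃] at hkill
      have e1 : A' y + d' = (A y + d) - ω • R₃ y - d 0 • E4.basisVector 0 := by
        rw [hA'apply, hd']; abel
      rw [e1, map_sub, map_sub, map_smul, map_smul, Kerr.fderiv_bilin_basisVector_zero M a (hdiff y hy),
        smul_zero, sub_zero, hA'apply, hA'apply]
      simp only [map_sub, map_smul, sub_apply, smul_apply, smul_eq_mul, add_apply, map_add]
      linear_combination (-ω) * hkill
    · rw [hn3] at hnA'
      have h0 : 0 ≤ |a|⁻¹ := inv_nonneg.2 (abs_nonneg a)
      nlinarith [norm_nonneg (A (E4.basisVector 0)), norm_nonneg (E4.spatial d),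
        norm_nonneg (a • A (E4.basisVector 3)), mul_nonneg h0 (norm_nonneg (A (E4.basisVector 0))),
        mul_nonneg h0 (norm_nonneg (E4.spatial d)), mul_nonneg h0 (norm_nonneg (a • A (E4.basisVector 3)))]

end Normalise

/-- **Registered one-line carrier form** (`coerSym_normalise_cs`, sub-goal of the crux item) of `coerSym_normalise`: normalisation of an infinitesimal Poincaré motion modulo the Kerr–Schild stabiliser. [folklore] -/
theorem coerSym_normalise_cs : open Literature.Geometry.Lorentzian in ∀ (M a : ℝ) {A : E4 →L[ℝ] E4}, (∀ u w : E4, Minkowski.bilin (A u) w + Minkowski.bilin u (A w) = 0) → ∀ (d : E4), ∃ (A' : E4 →L[ℝ] E4) (d' : E4), (∀ u w : E4, Minkowski.bilin (A' u) w + Minkowski.bilin u (A' w) = 0) ∧ (∀ y : E4, 0 < Kerr.radius a y → ∀ v w : E4, fderiv ℝ (Kerr.bilin M a) y (A' y + d') v w + Kerr.bilin M a y (A' v) w + Kerr.bilin M a y v (A' w) = fderiv ℝ (Kerr.bilin M a) y (A y + d) v w + Kerr.bilin M a y (A v) w + Kerr.bilin M a y v (A w)) ∧ A' (E4.basisVector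 0) = A (E4.basisVector 0) ∧ E4.spatial d' = E4.spatial d ∧ a • A' (E4.basisVector 3) = a • A (E4.basisVector 3) ∧ ‖A'‖ ≤ (3 + 3 * |a|⁻¹) * (‖A (E4.basisVector 0)‖ + ‖E4.spatial d‖ + ‖a • A (E4.basisVector 3)‖) ∧ ‖d'‖ ≤ ‖A (E4.basisVector 0)‖ + ‖E4.spatial d‖ + ‖a • A (E4.basisVector 3)‖ :=
  fun M a _ hA d ↦ coerSym_normalise M a hA d

end Summit.FinalStateConjecture.FinalStateConjecture.Theorems.SublinearIsFree.Slaving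

end
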